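import Literature.AlgebraicGeometry.Motives.AbelianVarietyArtinSolomonRelationIsogenies
import HarnessLib

/-!
# The permutation characters of pairwise non-conjugate CYCLIC subgroups are linearly independent; "Cyclic groups
# have no non-zero relations" (Bartel–Dokchitser §2, Example 1) — the uniqueness side of Artin's relation, in the
# marks currency of the Kani–Rosen engine

Layer A1/A2 of the Hodge foundations lane (`lit-hodgefound`, row A1-20⁺ · A2, seat p03 generation 26, row g26-#4);
companion of `Motives/AbelianVarietyArtinSolomonRelationIsogenies` (g26-#2: EXISTENCE of Artin's relation
`|G| · 1_G = Σ_C b_C (1_C)^G` over cyclic `C` and its Kani–Rosen isogeny; CONSUMED by name here: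
`card_mul_indClassFun_one_apply`, `|G| · (1_H)^G(g) = [G:H] · m_H(g)`).  Bartel–Dokchitser, after recalling Artin's
relations: "These are clearly linearly independent, and thus give a basis of `K(G) ⊗ ℚ`. Example 1. Cyclic groups
have no non-zero relations."  This file proves the "clearly": an integral combination `Σ_i a_i m_{C_i}` of the MARKS
(equivalently `Σ_i a_i (1_{C_i})^G` of the permutation characters) of pairwise non-conjugate cyclic subgroups that
vanishes identically has all `a_i = 0`; for a cyclic `G` (all subgroups cyclic and normal) there is therefore NO
Brauer relation at all — the negative complement of the series: Kani–Rosen's Theorem 3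
(`Motives/AbelianVarietyBrauerRelationIsogenies`) produces no isogeny relation from a cyclic group action beyond
tautologies.  Everything here is PROVED; NO definition, NO named fact (net Literature debt 0); no abelian variety
occurs in the statements (pure group/character theory in the namespace of the series, which it closes).

## Sources, verbatim

A. Bartel, T. Dokchitser, *Brauer relations in finite groups*, J. Eur. Math. Soc. **17** (2015) 2473–2512 (arXiv
1103.2047, held `paper:arxiv-1103.2047`), §2 p0006: "The number of isomorphism classes of irreducible rational
representations of a finite group `G` is equal to the number of conjugacy classes of cyclic subgroups of `G` […].
Since the cokernel of `B(G) → R_ℚ(G)` is finite […], the rank of the kernel `K(G)` is the number of conjugacy classes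
of non-cyclic subgroups. Explicitly, Artin's induction theorem gives a relation for each non-cyclic subgroup `H` of
`G`, `|H|·1 = Σ_C n_C C`, `n_C ∈ ℤ`, the sum taken over the cyclic subgroups of `H`. These are clearly linearly
independent, and thus give a basis of `K(G) ⊗ ℚ`. **Example 1.** Cyclic groups have no non-zero relations."
I. M. Isaacs, *Character Theory of Finite Groups* (1976), proof of Thm. 5.21 (p. 73): "`a_j = 0` unless `H_j` is
conjugate to a subgroup of `H_i` […] We prove by induction on `n_i`" — the same triangularity (a generator of `⟨x_i⟩`
has non-zero mark only on subgroups containing a conjugate of `⟨x_i⟩`).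

## What is proved (namespace `Literature.AlgebraicGeometry.Motives.AbelianVariety`)

`G` finite; `C : ι → Subgroup G` a finite family, `hcyc : ∀ i, ∃ z, C i = ⟨z⟩` (cyclic), `hnc` (pairwise
non-conjugate: `C j = xC_ix⁻¹ ⟹ i = j`, conjugates as `(C i).map (MulAut.conj x)`); marks `m_C(g) =
|{x : x⁻¹gx ∈ C}|`; `(1_C)^G = indClassFun C 1`.
* `eq_map_conj_of_conj_mem_of_card_le` — a generator `g` of `C₀` conjugate into `C` with `|C| ≤ |C₀|` forces
  `C = x⁻¹C₀x` (the triangularity step);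
* **`eq_zero_of_sum_mul_card_conj_mem_eq_zero`** — `Σ_i a_i m_{C_i}(g) = 0 ∀ g ⟹ a = 0` (maximal-order argument);
* **`eq_zero_of_sum_smul_indClassFun_zpowers_eq_zero`** — `Σ_i a_i (1_{C_i})^G = 0 ⟹ a = 0` and the uniqueness of
  coefficients `eq_of_sum_smul_indClassFun_zpowers_eq`;
* **`eq_zero_of_sum_mul_card_conj_mem_eq_zero_of_isCyclic`**, **`eq_zero_of_sum_smul_indClassFun_eq_zero_of_isCyclic`**
  — Example 1: for a CYCLIC `G` and DISTINCT subgroups `C_i`, no relation `Σ_i a_i m_{C_i} = 0` /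
  `Σ_i a_i (1_{C_i})^G = 0` except `a = 0`.

Scope (stated, not hidden). (1) Only the linear independence (over `ℤ`, hence over `ℚ`) is proved; the rank statement
"`rank K(G) =` number of conjugacy classes of non-cyclic subgroups" (which also needs the Artin relation of every
non-cyclic `H ≤ G` induced to `G` and the Burnside ring `B(G)`) is not formalised.  (2) No abelian variety occurs:
the Kani–Rosen reading ("no isogeny relation from cyclic actions") is the contrapositive use of
`isIsogenous_of_sum_intCast_smul_indClassFun_one_eq_zero` of the companion file and is not restated as a theorem.

## References

* [BartelDokchitser2015] A. Bartel, T. Dokchitser, *Brauer relations in finite groups*, J. Eur. Math. Soc. 17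
  (2015), §2 (Artin relations, "clearly linearly independent", Example 1).
* [Isaacs1976] I. M. Isaacs, *Character Theory of Finite Groups* (1976), Thm. 5.21 and its proof.
-/

noncomputable section

open Literature.RepresentationTheory.FiniteGroups

namespace Literature.AlgebraicGeometry.Motives

namespace AbelianVariety

/-! ## Linear independence of the marks / permutation characters of non-conjugate cyclic subgroups -/

section CyclicIndependence

variable {G : Type} [Group G] [Finite G] {ι : Type} [Fintype ι] (C : ι → Subgroup G)

/-- If `g` generates `C₀ = ⟨g⟩` and some conjugate `x⁻¹gx` lies in a subgroup `C` with `|C| ≤ |C₀|`, then `C = x⁻¹C₀x` is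
conjugate to `C₀` (the marks `m_C(g)` of a generator of `C₀` vanish off the conjugates of subgroups containing a
conjugate of `C₀`). [cite: BartelDokchitser2015, §2 ("These are clearly linearly independent")] -/
theorem eq_map_conj_of_conj_mem_of_card_le {g x : G} (C₀ C : Subgroup G) (hC₀ : C₀ = Subgroup.zpowers g)
    (hx : x⁻¹ * g * x ∈ C) (hle : Nat.card C ≤ Nat.card C₀) : C = C₀.map (MulAut.conj x⁻¹).toMonoidHom := by
  have hmap : C₀.map (MulAut.conj x⁻¹).toMonoidHom = Subgroup.zpowers (x⁻¹ * g * x) := by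
    rw [hC₀, MonoidHom.map_zpowers, MulEquiv.coe_toMonoidHom, MulAut.conj_apply, inv_inv]
  have hle' : C₀.map (MulAut.conj x⁻¹).toMonoidHom ≤ C := by
    rw [hmap]
    exact (Subgroup.zpowers_le (G := G)).2 hx
  symm
  refine Subgroup.eq_of_le_of_card_ge hle' ?_
  rw [Subgroup.card_map_of_injective (MulAut.conj x⁻¹).injective]
  exact hle

/-- **The permutation characters of pairwise non-conjugate CYCLIC subgroups are linearly independent** — marks form:
if `C_i = ⟨z_i⟩` are cyclic, no two conjugate, and `Σ_i a_i m_{C_i}(g) = 0` for every `g ∈ G` (`a_i ∈ ℤ`,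
`m_C(g) = |{x : x⁻¹gx ∈ C}| = |C| · (1_C)^G(g)`), then all `a_i = 0` (take `i₀` with `a_{i₀} ≠ 0` and `|C_{i₀}|`
maximal and evaluate at a generator of `C_{i₀}`: every other `C_i` with `a_i ≠ 0` has `m_{C_i} = 0` there).  With
Artin's relation (`Motives/AbelianVarietyArtinSolomonRelationIsogenies`) this is "the rank of `K(G)` is the number of
conjugacy classes of non-cyclic subgroups", lower half. [cite: BartelDokchitser2015, §2 ("These are clearly linearly independent, and thus give a basis of K(G) ⊗ ℚ")] -/
theorem eq_zero_of_sum_mul_card_conj_mem_eq_zero (hcyc : ∀ i, ∃ z : G, C i = Subgroup.zpowers z)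
    (hnc : ∀ i j (x : G), C j = (C i).map (MulAut.conj x).toMonoidHom → i = j) (a : ι → ℤ)
    (h : ∀ g : G, ∑ i, a i * (Nat.card {x : G // x⁻¹ * g * x ∈ C i} : ℤ) = 0) (i : ι) : a i = 0 := by
  classical
  by_contra hai
  -- a subgroup of maximal order among those with a non-zero coefficient
  obtain ⟨i₀, hi₀, hmax⟩ := Finset.exists_max_image (Finset.univ.filter fun j ↦ a j ≠ 0)
    (fun j ↦ Nat.card (C j)) ⟨i, Finset.mem_filter.2 ⟨Finset.mem_univ _, hai⟩⟩
  have ha₀ : a i₀ ≠ 0 := (Finset.mem_filter.1 hi₀).2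
  obtain ⟨z, hz⟩ := hcyc i₀
  -- at the generator `z` of `C_{i₀}` every other relevant mark vanishes
  have key : ∀ j, j ≠ i₀ → a j * (Nat.card {x : G // x⁻¹ * z * x ∈ C j} : ℤ) = 0 := by
    intro j hj
    by_cases haj : a j = 0
    · rw [haj, zero_mul]
    refine mul_eq_zero_of_right _ ?_
    rw [Nat.cast_eq_zero, Nat.card_eq_zero]
    refine Or.inl ⟨fun x ↦ hj ?_⟩
    have hle : Nat.card (C j) ≤ Nat.card (C i₀) := hmax j (Finset.mem_filter.2 ⟨Finset.mem_univ _, haj⟩)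
    exact (hnc i₀ j x.1⁻¹ (eq_map_conj_of_conj_mem_of_card_le (C i₀) (C j) hz x.2 hle)).symm
  have hsum := h z
  rw [Finset.sum_eq_single i₀ (fun j _ hj ↦ key j hj) (fun h ↦ (h (Finset.mem_univ _)).elim)] at hsum
  have hpos : 0 < Nat.card {x : G // x⁻¹ * z * x ∈ C i₀} :=
    Nat.card_pos_iff.2 ⟨⟨⟨1, by rw [inv_one, one_mul, mul_one, hz]; exact Subgroup.mem_zpowers z⟩⟩, inferInstance⟩
  rcases mul_eq_zero.1 hsum with h0 | h0
  · exact ha₀ h0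
  · exact (Nat.cast_eq_zero.1 h0 ▸ hpos).false

variable [Fintype G]

/-- **The same for permutation characters**: `Σ_i a_i (1_{C_i})^G = 0` with `C_i` cyclic, pairwise non-conjugate and
`a_i ∈ ℤ` forces `a_i = 0` ("Artin's induction theorem gives a relation for each non-cyclic subgroup … the sum taken over
the cyclic subgroups … These are clearly linearly independent"). [cite: BartelDokchitser2015, §2] [cite: Isaacs1976, Thm. 5.21 (proof)] -/
theorem eq_zero_of_sum_smul_indClassFun_zpowers_eq_zero (hcyc : ∀ i, ∃ z : G, C i = Subgroup.zpowers z)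
    (hnc : ∀ i j (x : G), C j = (C i).map (MulAut.conj x).toMonoidHom → i = j) (a : ι → ℤ)
    (h : ∑ i, (a i : ℂ) • indClassFun (C i) (1 : C i → ℂ) = 0) (i : ι) : a i = 0 := by
  have hm : ∀ g : G, ∑ i, (a i * (C i).index) * (Nat.card {x : G // x⁻¹ * g * x ∈ C i} : ℤ) = 0 := fun g ↦ by
    have hg := congrArg (fun f : G → ℂ ↦ (Fintype.card G : ℂ) * f g) h
    simp only [Finset.sum_apply, Pi.smul_apply, smul_eq_mul, Finset.mul_sum, Pi.zero_apply, mul_zero] at hg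
    have e : ∀ i, (Fintype.card G : ℂ) * ((a i : ℂ) * indClassFun (C i) (1 : C i → ℂ) g) =
        ((a i * (C i).index * (Nat.card {x : G // x⁻¹ * g * x ∈ C i} : ℤ) : ℤ) : ℂ) := fun i ↦ by
      rw [mul_left_comm, card_mul_indClassFun_one_apply]; push_cast; ring
    rw [Finset.sum_congr rfl fun i _ ↦ e i, ← Int.cast_sum] at hg
    exact_mod_cast hg
  have h0 := eq_zero_of_sum_mul_card_conj_mem_eq_zero C hcyc hnc (fun i ↦ a i * (C i).index) hm i
  rcases mul_eq_zero.1 h0 with h | h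
  · exact h
  · exact absurd (Nat.cast_eq_zero.1 h) (Subgroup.index_ne_zero_of_finite)

omit [Fintype G] in
/-- **"Cyclic groups have no non-zero relations"** (Bartel–Dokchitser's Example 1), marks form: in a finite cyclic
group `G` every subgroup is cyclic and normal, so for DISTINCT subgroups `C_i` and integers `a_i`,
`Σ_i a_i m_{C_i}(g) = 0` for all `g` forces all `a_i = 0` — the permutation characters of the subgroups of a cyclic
group admit no relation; in particular Kani–Rosen's Theorem 3 yields no isogeny relation for cyclic group actions
beyond the trivial ones. [cite: BartelDokchitser2015, §2 Example 1 ("Cyclic groups have no non-zero relations")] -/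
theorem eq_zero_of_sum_mul_card_conj_mem_eq_zero_of_isCyclic [IsCyclic G] (hC : Function.Injective C) (a : ι → ℤ)
    (h : ∀ g : G, ∑ i, a i * (Nat.card {x : G // x⁻¹ * g * x ∈ C i} : ℤ) = 0) (i : ι) : a i = 0 := by
  have hcomm : ∀ u v : G, u * v = v * u := fun u v ↦ IsCyclic.commGroup.mul_comm u v
  refine eq_zero_of_sum_mul_card_conj_mem_eq_zero C (fun j ↦ ?_) (fun j k x hjk ↦ hC ?_) a h i
  · obtain ⟨z, hz⟩ := (C j).isCyclic_iff_exists_zpowers_eq_top.1 inferInstance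
    exact ⟨z, hz.symm⟩
  · rw [hjk]
    ext y
    rw [Subgroup.mem_map_equiv, MulAut.conj_symm_apply, mul_assoc, hcomm y x, ← mul_assoc, inv_mul_cancel, one_mul]

/-- **Example 1 for permutation characters**: in a finite cyclic group, `Σ_i a_i (1_{C_i})^G = 0` for distinct
subgroups `C_i` and `a_i ∈ ℤ` forces `a_i = 0`. [cite: BartelDokchitser2015, §2 Example 1] -/
theorem eq_zero_of_sum_smul_indClassFun_eq_zero_of_isCyclic [IsCyclic G] (hC : Function.Injective C) (a : ι → ℤ)
    (h : ∑ i, (a i : ℂ) • indClassFun (C i) (1 : C i → ℂ) = 0) (i : ι) : a i = 0 := by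
  have hcomm : ∀ u v : G, u * v = v * u := fun u v ↦ IsCyclic.commGroup.mul_comm u v
  refine eq_zero_of_sum_smul_indClassFun_zpowers_eq_zero C (fun j ↦ ?_) (fun j k x hjk ↦ hC ?_) a h i
  · obtain ⟨z, hz⟩ := (C j).isCyclic_iff_exists_zpowers_eq_top.1 inferInstance
    exact ⟨z, hz.symm⟩
  · rw [hjk]
    ext y
    rw [Subgroup.mem_map_equiv, MulAut.conj_symm_apply, mul_assoc, hcomm y x, ← mul_assoc, inv_mul_cancel, one_mul]

/-- **Uniqueness of coefficients**: two integral combinations of the permutation characters of pairwise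
non-conjugate cyclic subgroups that agree as functions have the same coefficients (so the coefficients of an
Artin-type relation `w · 1_G = Σ_C b_C (1_C)^G`, once the cyclic `C` are taken up to conjugacy, are unique).
[cite: BartelDokchitser2015, §2 ("a basis of K(G) ⊗ ℚ")] [cite: Isaacs1976, Thm. 5.21] -/
theorem eq_of_sum_smul_indClassFun_zpowers_eq (hcyc : ∀ i, ∃ z : G, C i = Subgroup.zpowers z)
    (hnc : ∀ i j (x : G), C j = (C i).map (MulAut.conj x).toMonoidHom → i = j) (a a' : ι → ℤ)
    (h : ∑ i, (a i : ℂ) • indClassFun (C i) (1 : C i → ℂ) = ∑ i, (a' i : ℂ) • indClassFun (C i) (1 : C i → ℂ)) :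
    a = a' := by
  funext i
  have h0 : ∑ i, ((a i - a' i : ℤ) : ℂ) • indClassFun (C i) (1 : C i → ℂ) = 0 := by
    simp only [Int.cast_sub, sub_smul, Finset.sum_sub_distrib, h, sub_self]
  exact sub_eq_zero.1 (eq_zero_of_sum_smul_indClassFun_zpowers_eq_zero C hcyc hnc (fun i ↦ a i - a' i) h0 i)

end CyclicIndependence

end AbelianVariety

end Literature.AlgebraicGeometry.Motives
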